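import Mathlib
import Literature.Geometry.Lorentzian.ReggeWheelerTortoise
import Literature.Geometry.Lorentzian.ReggeWheelerChannels
import Summits.FinalStateConjecture.FinalStateConjecture.Theorems.PhotonSphereChannelsUniformPhotonSphereChannelsRSeriesChainCalculus

/-!
# Crux `UniformPhotonSphereChannelsR` (K1R, stmt-FinalStateConjecture-14074), line
# `crum-peeling-recessive-tower` — stub `stub_seriesChain` (the analytic germs solve the chain)

The registered stub `stub_seriesChain` of the line's skeleton v4 (continuation lead c2).  Along a
tortoise radius function `r` (`r > 2M`, `dr/dx = 1 − 2M/r`, `r(x_c) = 3M`) put `w = M/r` and, for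
coefficient sequences `Ω k` with `Ω k 0 = 1` and geometric control `|Ω k n| ≤ Rⁿ` (`R ≥ 1`),
the germs `Wa k x = −((ℓ − k)/r x) · Σₙ Ω k n (M/r x)ⁿ` (absolutely convergent for `r > 2RM`,
i.e. `|w| < 1/(2R)`).  With `S = Σ Ωₙ wⁿ`, `D = Σ (n+1) Ωₙ wⁿ = (wS)′` and `λ = ℓ − k` the chain
rule (`dw/dx = −(1 − 2M/r) w/r`) gives

  `Wa k′ = λ (1 − 2M/r) D / r²`,  `Wa k² = λ² S² / r²`,

so `Wa k′ + Wa k²` is `r⁻²` times the *Riccati form* `λ² S² + λ(1 − 2w) D` of the helper file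
`…RSeriesChainCalculus`, whose power-series coefficients are exactly the registered expressions
`λ² Σ_{i≤n} Ωᵢ Ωₙ₋ᵢ + λ((n+1)Ωₙ − 2nΩₙ₋₁)`.  Hence

* the rung-0 recursion (coefficients `ℓ(ℓ+1)`, `2(1−s²) − 2ℓ(ℓ+1)`, `−4(1−s²)`, `0, 0, …`) says
  `Wa 0′ + Wa 0² = r⁻²(1 − 2w)(ℓ(ℓ+1) + 2(1−s²)w) = V_{s,ℓ}(r) = Ua 0` (`germ_riccati_zero`);
* the rung maps say `Wa (k+1)′ + Wa (k+1)² = Wa k² − Wa k′` (`germ_riccati_succ`);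
* induction on `k` with `Ua (k+1) = 2 Wa k² − Ua k` gives `Wa k′ = Ua k − Wa k²` on `{r > 2RM}`
  for every `k < ℓ` (first clause);
* `x · Wa k x → k − ℓ` (second clause): `Σ Ωₙ wⁿ → Ω₀ = 1` as `w = M/r → 0`
  (`IsTortoiseRadius.tendsto_atTop`) and `x / r x → 1`, read off the tortoise identity
  `x = x_c + r + 2M log(r − 2M) − 3M − 2M log M` (`IsTortoiseRadius.tortoiseCoord_eq`) and
  `log ρ / ρ → 0` (`tendsto_div_tortoise`).

No hypothesis on `s` is needed.  Elementary given the helper file.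
-/

-- `Summit.<S>.<S>` repeats a namespace component by design (D-0017); off here as in the lakefile.
set_option linter.dupNamespace false

noncomputable section

namespace Summit.FinalStateConjecture.FinalStateConjecture.Theorems.CrumPeelingRecessiveTower

open Literature.Geometry.Lorentzian Literature.Geometry.Lorentzian.ReggeWheeler MeasureTheory
  Filter Set Topology
open scoped ENNReal

variable {M : ℝ} {r : ℝ → ℝ} {xc : ℝ}

/-- Beyond `r = 2RM` the expansion variable `w = M/r` satisfies `|w| < 1/(2R)`. [folklore] -/
theorem abs_div_tortoise_lt (hr : IsTortoiseRadius M r xc) {R : ℝ} (hR : 1 ≤ R) {x : ℝ}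
    (hx : 2 * R * M < r x) : |M / r x| < 1 / (2 * R) := by
  have hM := hr.mass_pos
  have hrx := hr.pos x
  rw [abs_of_pos (div_pos hM hrx), div_lt_div_iff₀ hrx (by linarith), one_mul]
  linarith [show M * (2 * R) = 2 * R * M from by ring]

/-- **Derivative of a germ.**  For `W x = −(c/r x) Σ aₙ (M/r x)ⁿ` with `|aₙ| ≤ Rⁿ` (`R ≥ 1`) and
`r x > 2RM`: `W′(x) = c (1 − 2M/r x) r(x)⁻² Σ (n+1) aₙ (M/r x)ⁿ` (chain rule through `w = M/r`,
`dw/dx = −(1 − 2M/r) M/r²`, and `W = −(c/M)·Σ aₙ wⁿ⁺¹`). [folklore] -/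
theorem hasDerivAt_germ (hr : IsTortoiseRadius M r xc) {a : ℕ → ℝ} {R : ℝ} (hR : 1 ≤ R)
    (ha : ∀ n, |a n| ≤ R ^ n) (c : ℝ) {W : ℝ → ℝ}
    (hW : ∀ x, W x = -(c / r x) * ∑' n, a n * (M / r x) ^ n) {x : ℝ} (hx : 2 * R * M < r x) :
    HasDerivAt W (c * (1 - 2 * M / r x) / r x ^ 2
      * ∑' n : ℕ, ((n : ℝ) + 1) * a n * (M / r x) ^ n) x := by
  have hM := hr.mass_pos
  have hM' : M ≠ 0 := hM.ne'
  have hrx := hr.pos x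
  have hrx' : r x ≠ 0 := hrx.ne'
  have hfun : W = fun y => -(c / M) * ∑' n, a n * (M / r y) ^ (n + 1) := by
    funext y
    rw [hW y, tsum_mul_pow_succ]
    have hry : r y ≠ 0 := (hr.pos y).ne'
    field_simp
  have hP := hasDerivAt_tsum_mul_pow_succ hR ha (abs_div_tortoise_lt hr hR hx)
  have hw : HasDerivAt (fun y => M / r y) ((0 * r x - M * (1 - 2 * M / r x)) / r x ^ 2) x :=
    (hasDerivAt_const x M).div (hr.hasDerivAt x) hrx'
  have hcomp := (hP.comp x hw).const_mul (-(c / M))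
  rw [hfun]
  refine hcomp.congr_deriv ?_
  field_simp
  ring

/-- **Rung 0: the germ solves the Riccati equation of the Regge–Wheeler potential.**  If the
coefficients satisfy the rung-0 recursion
`ℓ² Σ_{i≤n} aᵢaₙ₋ᵢ + ℓ((n+1)aₙ − 2n aₙ₋₁) = [ℓ(ℓ+1), 2(1−s²) − 2ℓ(ℓ+1), −4(1−s²), 0, 0, …]ₙ`, then
for `r x > 2RM`, with `w = M/r x`,
`ℓ(1 − 2M/r)r⁻² Σ(n+1)aₙwⁿ + (−(ℓ/r) Σ aₙwⁿ)² = V_{s,ℓ}(r x)`. [folklore] -/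
theorem germ_riccati_zero (hr : IsTortoiseRadius M r xc) {a : ℕ → ℝ} {R : ℝ} (hR : 1 ≤ R)
    (ha : ∀ n, |a n| ≤ R ^ n) (s ℓ : ℕ)
    (hrec : ∀ n, (ℓ : ℝ) ^ 2 * ∑ i ∈ Finset.range (n + 1), a i * a (n - i)
          + (ℓ : ℝ) * (((n : ℝ) + 1) * a n - 2 * (n : ℝ) * a (n - 1))
          = (if n = 0 then (ℓ : ℝ) * ((ℓ : ℝ) + 1)
             else if n = 1 then 2 * (1 - (s : ℝ) ^ 2) - 2 * ((ℓ : ℝ) * ((ℓ : ℝ) + 1))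
             else if n = 2 then -(4 * (1 - (s : ℝ) ^ 2)) else 0))
    {x : ℝ} (hx : 2 * R * M < r x) :
    (ℓ : ℝ) * (1 - 2 * M / r x) / r x ^ 2 * (∑' n : ℕ, ((n : ℝ) + 1) * a n * (M / r x) ^ n)
      + (-((ℓ : ℝ) / r x) * ∑' n, a n * (M / r x) ^ n) ^ 2
      = rwPotential M s ℓ (r x) := by
  have hrx' : r x ≠ 0 := (hr.pos x).ne'
  have hid := riccatiForm_eq_poly hR ha (abs_div_tortoise_lt hr hR hx) hrec
  unfold rwPotential
  set S : ℝ := ∑' n, a n * (M / r x) ^ n with hS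
  set D : ℝ := ∑' n : ℕ, ((n : ℝ) + 1) * a n * (M / r x) ^ n with hD
  have e1 : (ℓ : ℝ) * (1 - 2 * M / r x) / r x ^ 2 * D + (-((ℓ : ℝ) / r x) * S) ^ 2
      = ((ℓ : ℝ) ^ 2 * S ^ 2 + (ℓ : ℝ) * (1 - 2 * (M / r x)) * D) / r x ^ 2 := by
    field_simp
    ring
  rw [e1, hid]
  field_simp
  ring

/-- **Rung map: consecutive germs satisfy the Crum/SUSY relation.**  If the Riccati-form
coefficients of `(b, d)` equal those of `(a, −c)` (the registered rung map, `d = λ − 1`,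
`c = λ`), then for `r x > 2RM`
`d(1−2M/r)r⁻² D_b + (−(d/r)S_b)² = (−(c/r)S_a)² − c(1−2M/r)r⁻² D_a`,
i.e. `W_b′ + W_b² = W_a² − W_a′`. [folklore] -/
theorem germ_riccati_succ (hr : IsTortoiseRadius M r xc) {a b : ℕ → ℝ} {R : ℝ} (hR : 1 ≤ R)
    (ha : ∀ n, |a n| ≤ R ^ n) (hb : ∀ n, |b n| ≤ R ^ n) {c d : ℝ}
    (hrec : ∀ n, d ^ 2 * ∑ i ∈ Finset.range (n + 1), b i * b (n - i)
          + d * (((n : ℝ) + 1) * b n - 2 * (n : ℝ) * b (n - 1))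
        = c ^ 2 * ∑ i ∈ Finset.range (n + 1), a i * a (n - i)
          - c * (((n : ℝ) + 1) * a n - 2 * (n : ℝ) * a (n - 1)))
    {x : ℝ} (hx : 2 * R * M < r x) :
    d * (1 - 2 * M / r x) / r x ^ 2 * (∑' n : ℕ, ((n : ℝ) + 1) * b n * (M / r x) ^ n)
      + (-(d / r x) * ∑' n, b n * (M / r x) ^ n) ^ 2
      = (-(c / r x) * ∑' n, a n * (M / r x) ^ n) ^ 2
        - c * (1 - 2 * M / r x) / r x ^ 2 * (∑' n : ℕ, ((n : ℝ) + 1) * a n * (M / r x) ^ n) := by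
  have hrx' : r x ≠ 0 := (hr.pos x).ne'
  have hid := riccatiForm_eq_of_coeff_eq hR ha hb (abs_div_tortoise_lt hr hR hx) hrec
  set Sa : ℝ := ∑' n, a n * (M / r x) ^ n with hSa
  set Da : ℝ := ∑' n : ℕ, ((n : ℝ) + 1) * a n * (M / r x) ^ n with hDa
  set Sb : ℝ := ∑' n, b n * (M / r x) ^ n with hSb
  set Db : ℝ := ∑' n : ℕ, ((n : ℝ) + 1) * b n * (M / r x) ^ n with hDb
  have e1 : d * (1 - 2 * M / r x) / r x ^ 2 * Db + (-(d / r x) * Sb) ^ 2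
      = (d ^ 2 * Sb ^ 2 + d * (1 - 2 * (M / r x)) * Db) / r x ^ 2 := by
    field_simp
    ring
  have e2 : (-(c / r x) * Sa) ^ 2 - c * (1 - 2 * M / r x) / r x ^ 2 * Da
      = (c ^ 2 * Sa ^ 2 - c * (1 - 2 * (M / r x)) * Da) / r x ^ 2 := by
    field_simp
  rw [e1, e2, hid]

/-- **`x / r x → 1` along the tortoise line.**  From the tortoise identity
`x − x_c = r + 2M log(r − 2M) − 3M − 2M log M` and `log ρ/ρ → 0`. [folklore] -/
theorem tendsto_div_tortoise (hr : IsTortoiseRadius M r xc) :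
    Tendsto (fun x => x / r x) atTop (𝓝 1) := by
  have hM := hr.mass_pos
  have hlog : Tendsto (fun ρ : ℝ => Real.log (ρ - 2 * M) / ρ) atTop (𝓝 0) := by
    have h := (Real.tendsto_pow_log_div_mul_add_atTop 1 (2 * M) 1 one_ne_zero).comp
      (tendsto_atTop_add_const_right atTop (-(2 * M)) tendsto_id)
    refine h.congr fun ρ => ?_
    simp only [Function.comp_def, pow_one, id, ← sub_eq_add_neg, one_mul, sub_add_cancel]
  have hconst : Tendsto (fun ρ : ℝ => (xc - 3 * M - 2 * M * Real.log M) / ρ) atTop (𝓝 0) :=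
    tendsto_const_nhds.div_atTop tendsto_id
  have hg : Tendsto (fun ρ : ℝ => (xc + tortoiseCoord M ρ) / ρ) atTop (𝓝 1) := by
    have h := (tendsto_const_nhds (x := (1 : ℝ)) (f := (atTop : Filter ℝ))).add
      (hconst.add (hlog.const_mul (2 * M)))
    rw [mul_zero, add_zero, add_zero] at h
    refine h.congr' ?_
    filter_upwards [eventually_gt_atTop (0 : ℝ)] with ρ hρ
    have hρ' : ρ ≠ 0 := hρ.ne'
    unfold tortoiseCoord
    field_simp
    ring
  refine (hg.comp hr.tendsto_atTop).congr fun x => ?_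
  simp only [Function.comp_def, hr.tortoiseCoord_eq, add_sub_cancel]

/-- **Recessive normalisation of a germ.**  For `W x = −(c/r x) Σ aₙ (M/r x)ⁿ` with `|aₙ| ≤ Rⁿ`
(`R ≥ 1`), `a₀ = 1`: `x · W x → −c` as `x → +∞` (`M/r → 0`, `Σ aₙwⁿ → a₀`, `x/r → 1`).
[folklore] -/
theorem tendsto_mul_germ (hr : IsTortoiseRadius M r xc) {a : ℕ → ℝ} {R : ℝ} (hR : 1 ≤ R)
    (ha : ∀ n, |a n| ≤ R ^ n) (ha0 : a 0 = 1) (c : ℝ) {W : ℝ → ℝ}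
    (hW : ∀ x, W x = -(c / r x) * ∑' n, a n * (M / r x) ^ n) :
    Tendsto (fun x => x * W x) atTop (𝓝 (-c)) := by
  have h1 := tendsto_div_tortoise hr
  have h2 : Tendsto (fun x => ∑' n, a n * (M / r x) ^ n) atTop (𝓝 1) := by
    have hw : Tendsto (fun x => M / r x) atTop (𝓝 0) := hr.tendsto_atTop.const_div_atTop M
    have h := (tendsto_tsum_mul_pow_nhds_zero hR ha).comp hw
    rw [ha0] at h
    exact h
  have h3 := (h1.mul h2).const_mul (-c)
  rw [mul_one, mul_one] at h3
  refine h3.congr fun x => ?_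
  rw [hW x]
  ring

/-- **Stub (the series solve the chain, size L).**  For `r > 2RM` the analytic germs
`Wa k = −(λ_k/r)·Σ Ω k n (M/r)ⁿ`, `λ_k = ℓ − k`, built from coefficient sequences with `Ω k 0 = 1`,
`|Ω k n| ≤ Rⁿ`, the rung-0 recursion and the rung maps, solve the recessive chain: with
`Ua 0 = V_{s,ℓ}(r)`, `Ua (k+1) = 2 Wa k² − Ua k`, every `Wa k` (`k < ℓ`) satisfies
`Wa k′ = Ua k − Wa k²` on `{r > 2RM}` and `x · Wa k x → k − ℓ`. [folklore] -/
theorem stub_seriesChain :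
    ∀ (M : ℝ) (r : ℝ → ℝ) (xc : ℝ), IsTortoiseRadius M r xc → ∀ (s ℓ : ℕ),
      ∀ (Ω : ℕ → ℕ → ℝ) (R : ℝ), 1 ≤ R → (∀ k, Ω k 0 = 1) → (∀ k, k + 1 ≤ ℓ → ∀ n, |Ω k n| ≤ R ^ n) →
      (∀ n, (ℓ : ℝ) ^ 2 * ∑ i ∈ Finset.range (n + 1), Ω 0 i * Ω 0 (n - i)
          + (ℓ : ℝ) * (((n : ℝ) + 1) * Ω 0 n - 2 * (n : ℝ) * Ω 0 (n - 1))
          = (if n = 0 then (ℓ : ℝ) * ((ℓ : ℝ) + 1)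
             else if n = 1 then 2 * (1 - (s : ℝ) ^ 2) - 2 * ((ℓ : ℝ) * ((ℓ : ℝ) + 1))
             else if n = 2 then -(4 * (1 - (s : ℝ) ^ 2)) else 0)) →
      (∀ k, k + 2 ≤ ℓ → ∀ n,
          ((ℓ : ℝ) - k - 1) ^ 2 * ∑ i ∈ Finset.range (n + 1), Ω (k + 1) i * Ω (k + 1) (n - i)
          + ((ℓ : ℝ) - k - 1) * (((n : ℝ) + 1) * Ω (k + 1) n - 2 * (n : ℝ) * Ω (k + 1) (n - 1))
          = ((ℓ : ℝ) - k) ^ 2 * ∑ i ∈ Finset.range (n + 1), Ω k i * Ω k (n - i)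
          - ((ℓ : ℝ) - k) * (((n : ℝ) + 1) * Ω k n - 2 * (n : ℝ) * Ω k (n - 1))) →
      ∀ (Wa Ua : ℕ → ℝ → ℝ),
        (∀ k x, Wa k x = -(((ℓ : ℝ) - k) / r x) * ∑' n, Ω k n * (M / r x) ^ n) →
        (∀ x, Ua 0 x = linePotential M s ℓ r x) →
        (∀ k x, Ua (k + 1) x = 2 * Wa k x ^ 2 - Ua k x) →
        (∀ k, k + 1 ≤ ℓ → ∀ x, 2 * R * M < r x → HasDerivAt (Wa k) (Ua k x - Wa k x ^ 2) x) ∧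
        (∀ k, k + 1 ≤ ℓ → Tendsto (fun x => x * Wa k x) atTop (𝓝 ((k : ℝ) - ℓ))) := by
  intro M r xc hr s ℓ Ω R hR hΩ0 hΩb hrec0 hrecS Wa Ua hWa hUa0 hUaS
  -- the explicit derivative of the `k`-th germ
  set Dk : ℕ → ℝ → ℝ := fun k x => ((ℓ : ℝ) - k) * (1 - 2 * M / r x) / r x ^ 2
    * ∑' n : ℕ, ((n : ℝ) + 1) * Ω k n * (M / r x) ^ n with hDk
  have hderiv : ∀ k, k + 1 ≤ ℓ → ∀ x, 2 * R * M < r x → HasDerivAt (Wa k) (Dk k x) x :=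
    fun k hk x hx => hasDerivAt_germ hr hR (hΩb k hk) ((ℓ : ℝ) - k) (hWa k) hx
  -- the Riccati identities, by induction along the chain
  have hricc : ∀ k, k + 1 ≤ ℓ → ∀ x, 2 * R * M < r x → Dk k x + Wa k x ^ 2 = Ua k x := by
    intro k
    induction k with
    | zero =>
      intro hℓ x hx
      have h := germ_riccati_zero hr hR (hΩb 0 hℓ) s ℓ hrec0 hx
      rw [hUa0 x, linePotential_apply, ← h, hDk, hWa 0 x]
      simp only [Nat.cast_zero, sub_zero]
    | succ k ih =>
      intro hk x hx
      have hk' : k + 1 ≤ ℓ := by omega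
      have hk2 : k + 2 ≤ ℓ := by omega
      have h := germ_riccati_succ hr hR (hΩb k hk') (hΩb (k + 1) hk) (hrecS k hk2) hx
      have hcast : ((ℓ : ℝ) - ((k + 1 : ℕ) : ℝ)) = (ℓ : ℝ) - k - 1 := by
        push_cast
        ring
      rw [hUaS k x, ← ih hk' x hx, hDk, hWa (k + 1) x]
      simp only [hcast]
      rw [h, hWa k x]
      ring
  refine ⟨fun k hk x hx => ?_, fun k hk => ?_⟩
  · have h := hderiv k hk x hx
    rw [← hricc k hk x hx, add_sub_cancel_right]
    exact h
  · have h := tendsto_mul_germ hr hR (hΩb k hk) (hΩ0 k) ((ℓ : ℝ) - k) (hWa k)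
    rw [neg_sub] at h
    exact h

end Summit.FinalStateConjecture.FinalStateConjecture.Theorems.CrumPeelingRecessiveTower
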